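import Literature.AlgebraicGeometry.Frobenioids.BCatOrbits
import HarnessLib

/-!
# The base category `B(G)` for an ARBITRARY topology on the group `G`: points, orbits, test objects

Mochizuki, *The geometry of Frobenioids I*, Kyushu J. Math. **62** (2008), §0 p. 13 ("`B(G)`", finite
sets with continuous `G`-action) [cite: MochizukiFrdI2008, §0 p.13]; used by *Frobenioids II*, Example
1.4 pp. 12–13 (`Q₀ = B(Gal(F̃/F))⁰`, `P₀ = B(D_v)⁰`) [cite: MochizukiFrdII2008, Ex. 1.4 p.12].

PROOF-ONLY companion of `BCatOrbits.lean`.  That toolkit assumes `[IsTopologicalGroup G]` wherever it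
BUILDS objects of `B(G) = ContAction FintypeCat G`, because it tests continuity through Mathlib's
`continuousSMul_iff_stabilizer_isOpen` (open stabilisers), which needs continuity of the group law.  The
typed [FrdII] Example 1.4 facts `NFLocCat.EConnected`, …, `NFLocCat.PTotallyEpimorphic` quantify over a
group `G` with an ARBITRARY `TopologicalSpace` structure (no compatibility with the group law is part of
their binders), so their universal closures are not reached by the landed witnesses (abc-iut FACT-LIST
rows F-0720, F-1167–F-1171, F-1175; R7 kernel type-audit DEMOTE:EXTRA-INSTANCE-HYP, abc-iut-w5-d088).

Here the same toolkit is re-proved with NO hypothesis relating the topology of `G` to its group law.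
The one observation: a finite discrete `G`-set `X` is continuous iff every transporter
`{g | g • x = y}` is open (`isContinuous_iff_isOpen_setOf_smul_eq`) — and the transporters of a trivial
`G`-set (`∅`/`univ`), of a `G`-stable subset of a continuous `G`-set (the same sets), and of a point of
a PRODUCT of continuous `G`-sets (intersections of two) are open with no compatibility at all.  The coset
objects `G/U` of `BCatOrbits.exists_coset_obj` (whose continuity DOES need translations to be
homeomorphisms) are replaced by the orbit of a pair `(q, q')` in `Q × Q'`
(`exists_pairOrbit_obj`), which has stabiliser `Stab(q) ∩ Stab(q')` and the same mapping property; this is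
all the [FrdII] Example 1.4 proofs use.  No definitions; nothing here bears on [IUTchIII].
-/

namespace Literature.AlgebraicGeometry.Frobenioids

namespace BCat

open CategoryTheory CategoryTheory.Limits
open scoped FintypeCatDiscrete

universe u

variable {G : Type u} [Group G] [TopologicalSpace G]

/-! ### Continuity of a finite `G`-set = openness of the transporters -/

/-- A finite (discrete) `G`-set is continuous iff every transporter `{g | g • x = y}` is open in `G` —
for an ARBITRARY topology on `G`. [cite: MochizukiFrdI2008, §0 p.13] -/
theorem isContinuous_iff_isOpen_setOf_smul_eq (X : Action FintypeCat.{u} G) :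
    Action.IsContinuous X ↔ ∀ x y : X.V, IsOpen {g : G | g • x = y} := by
  constructor
  · intro h x y
    have h' : ContinuousSMul G X.V := h
    have hc : Continuous fun g : G => g • x := by fun_prop
    exact (continuous_discrete_rng.mp hc) y
  · intro h
    have h' : ContinuousSMul G X.V := ⟨by
      rw [continuous_prod_of_discrete_right]
      intro x
      rw [continuous_discrete_rng]
      intro y
      exact h x y⟩
    exact h'

/-- The transporters `{g | g • x = y}` between points of an object of `B(G)` are open.
[cite: MochizukiFrdI2008, §0 p.13] -/
theorem isOpen_setOf_smul_eq (X : BCat G) (x y : X.obj.V) : IsOpen {g : G | g • x = y} :=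
  (isContinuous_iff_isOpen_setOf_smul_eq X.obj).mp X.property x y

/-- A finite `G`-set on which `G` acts trivially is continuous, for an arbitrary topology on `G`
(its transporters are `univ` or `∅`). [cite: MochizukiFrdI2008, §0 p.13] -/
theorem isContinuous_of_smul_eq' (X : Action FintypeCat.{u} G)
    (h : ∀ (g : G) (x : X.V), g • x = x) : Action.IsContinuous X :=
  (isContinuous_iff_isOpen_setOf_smul_eq X).mpr fun x y => by
    by_cases hxy : x = y
    · subst hxy
      have : {g : G | g • x = x} = Set.univ := Set.eq_univ_of_forall fun g => h g x
      rw [this]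
      exact isOpen_univ
    · have : {g : G | g • x = y} = ∅ :=
        Set.eq_empty_iff_forall_notMem.mpr fun g hg => hxy ((h g x).symm.trans hg)
      rw [this]
      exact isOpen_empty

/-! ### Non-initial objects, connected objects = single orbits (arbitrary topology on `G`) -/

/-- An object of `B(G)` with a point is non-initial (map it to the empty `G`-set) — arbitrary topology
on `G`. [cite: MochizukiFrdI2008, §0 p.15] -/
theorem isNonemptyObj_of_nonempty' (X : BCat G) (x : X.obj.V) : IsNonemptyObj X := by
  constructor
  intro hI
  let EA : Action FintypeCat.{u} G := { V := FintypeCat.of PEmpty.{u + 1}, ρ := 1 }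
  have hE : Action.IsContinuous EA :=
    (isContinuous_iff_isOpen_setOf_smul_eq EA).mpr fun z => z.elim
  let E : BCat G := ⟨EA, hE⟩
  exact ((hI.to E).hom.hom x : PEmpty).elim

/-- A nonempty transitive object of `B(G)` is connected in the sense of [FrdI] §0 (test against the
two-point trivial `G`-set) — arbitrary topology on `G`. [cite: MochizukiFrdI2008, §0 p.15] -/
theorem isConnectedObj_of_transitive' (X : BCat G) (x₀ : X.obj.V)
    (htr : ∀ x : X.obj.V, ∃ g : G, g • x₀ = x) : IsConnectedObj X := by
  refine ⟨isNonemptyObj_of_nonempty' X x₀, fun B₁ B₂ ι₁ ι₂ h₁ h₂ => ⟨fun hc => ?_⟩⟩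
  obtain ⟨b₁⟩ := nonempty_of_isNonemptyObj B₁ h₁
  obtain ⟨b₂⟩ := nonempty_of_isNonemptyObj B₂ h₂
  let ΩA : Action FintypeCat.{u} G := { V := FintypeCat.of (ULift.{u} Bool), ρ := 1 }
  have hΩ : Action.IsContinuous ΩA := isContinuous_of_smul_eq' ΩA fun _ _ => rfl
  let Ω : BCat G := ⟨ΩA, hΩ⟩
  let c : ∀ (Y : BCat G), Bool → (Y ⟶ Ω) := fun Y t => ObjectProperty.homMk
    { hom := FintypeCat.homMk fun _ => ULift.up t
      comm := fun _ => FintypeCat.hom_ext _ _ fun _ => rfl }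
  let u : X ⟶ Ω := hc.desc (BinaryCofan.mk (c B₁ false) (c B₂ true))
  have hu₁ : ι₁ ≫ u = c B₁ false := hc.fac _ ⟨WalkingPair.left⟩
  have hu₂ : ι₂ ≫ u = c B₂ true := hc.fac _ ⟨WalkingPair.right⟩
  have hconst : ∀ x : X.obj.V, u.hom.hom x = u.hom.hom x₀ := fun x => by
    obtain ⟨g, rfl⟩ := htr x
    rw [hom_smul]
    rfl
  have e₁ : u.hom.hom (ι₁.hom.hom b₁) = ULift.up false :=
    congrArg (fun k : B₁ ⟶ Ω => k.hom.hom b₁) hu₁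
  have e₂ : u.hom.hom (ι₂.hom.hom b₂) = ULift.up true :=
    congrArg (fun k : B₂ ⟶ Ω => k.hom.hom b₂) hu₂
  rw [hconst] at e₁ e₂
  exact Bool.false_ne_true (ULift.up_injective (e₁.symm.trans e₂))

/-- A connected object of `B(G)` is a single `G`-orbit: otherwise it is the coproduct, in `B(G)`, of an
orbit and its stable complement (`G`-stable subsets of a continuous `G`-set are continuous `G`-sets for
ANY topology on `G`). [cite: MochizukiFrdI2008, §0 p.15] -/
theorem exists_smul_eq_of_isConnectedObj' (X : BCat G) (hX : IsConnectedObj X) (x y : X.obj.V) :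
    ∃ g : G, g • x = y := by
  classical
  by_contra hy
  let subA : ∀ (T : Set X.obj.V), (∀ (g : G) (z : X.obj.V), z ∈ T → g • z ∈ T) →
      Action FintypeCat.{u} G := fun T hT =>
    { V := FintypeCat.of T
      ρ :=
        { toFun := fun g => FintypeCat.homMk fun z : T => (⟨g • z.1, hT g z.1 z.2⟩ : T)
          map_one' := FintypeCat.hom_ext _ _ fun z => Subtype.ext (one_smul G z.1)
          map_mul' := fun g h => FintypeCat.hom_ext _ _ fun z => Subtype.ext (mul_smul g h z.1) } }
  have subA_cont : ∀ T hT, Action.IsContinuous (subA T hT) := fun T hT =>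
    (isContinuous_iff_isOpen_setOf_smul_eq _).mpr fun z w => by
      convert isOpen_setOf_smul_eq X z.1 w.1 using 1
      ext g
      simp only [Set.mem_setOf_eq]
      constructor
      · intro h
        exact congrArg Subtype.val h
      · intro h
        exact Subtype.ext h
  let sub : ∀ (T : Set X.obj.V), (∀ (g : G) (z : X.obj.V), z ∈ T → g • z ∈ T) → BCat G :=
    fun T hT => ⟨subA T hT, subA_cont T hT⟩
  let incl : ∀ T hT, sub T hT ⟶ X := fun T hT => ObjectProperty.homMk
    { hom := FintypeCat.homMk fun z : T => z.1
      comm := fun _ => FintypeCat.hom_ext _ _ fun _ => rfl }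
  let S : Set X.obj.V := MulAction.orbit G x
  have hS : ∀ (g : G) (z : X.obj.V), z ∈ S → g • z ∈ S := fun g z hz => by
    obtain ⟨g', rfl⟩ := MulAction.mem_orbit_iff.mp hz
    exact MulAction.mem_orbit_iff.mpr ⟨g * g', mul_smul g g' x⟩
  have hSc : ∀ (g : G) (z : X.obj.V), z ∈ Sᶜ → g • z ∈ Sᶜ := fun g z hz hgz => by
    apply hz
    obtain ⟨g', hg'⟩ := MulAction.mem_orbit_iff.mp hgz
    exact MulAction.mem_orbit_iff.mpr ⟨g⁻¹ * g', by rw [mul_smul, hg', inv_smul_smul]⟩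
  have hxS : x ∈ S := MulAction.mem_orbit_self x
  have hyS : y ∈ Sᶜ := fun h => hy (MulAction.mem_orbit_iff.mp h)
  let desc : ∀ (T : BCat G), (sub S hS ⟶ T) → (sub Sᶜ hSc ⟶ T) → (X ⟶ T) := fun T f g =>
    ObjectProperty.homMk
      { hom := FintypeCat.homMk fun z : X.obj.V =>
          if h : z ∈ S then f.hom.hom ⟨z, h⟩ else g.hom.hom ⟨z, h⟩
        comm := fun g₀ => FintypeCat.hom_ext _ _ fun z : X.obj.V => by
          change (if h : g₀ • z ∈ S then f.hom.hom ⟨g₀ • z, h⟩ else g.hom.hom ⟨g₀ • z, h⟩) =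
            g₀ • (if h : z ∈ S then f.hom.hom ⟨z, h⟩ else g.hom.hom ⟨z, h⟩)
          by_cases hz : z ∈ S
          · rw [dif_pos hz, dif_pos (hS g₀ z hz)]
            exact hom_smul f g₀ ⟨z, hz⟩
          · rw [dif_neg hz, dif_neg (hSc g₀ z hz)]
            exact hom_smul g g₀ ⟨z, hz⟩ }
  have desc_applyS : ∀ (T : BCat G) (f : sub S hS ⟶ T) (g : sub Sᶜ hSc ⟶ T) (z : X.obj.V)
      (hz : z ∈ S), (desc T f g).hom.hom z = f.hom.hom ⟨z, hz⟩ := fun T f g z hz => by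
    change (if h : z ∈ S then f.hom.hom ⟨z, h⟩ else g.hom.hom ⟨z, h⟩) = _
    rw [dif_pos hz]
  have desc_applySc : ∀ (T : BCat G) (f : sub S hS ⟶ T) (g : sub Sᶜ hSc ⟶ T) (z : X.obj.V)
      (hz : z ∈ Sᶜ), (desc T f g).hom.hom z = g.hom.hom ⟨z, hz⟩ := fun T f g z hz => by
    change (if h : z ∈ S then f.hom.hom ⟨z, h⟩ else g.hom.hom ⟨z, h⟩) = _
    rw [dif_neg (show z ∉ S from hz)]
  have hcolim : IsColimit (BinaryCofan.mk (incl S hS) (incl Sᶜ hSc)) :=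
    BinaryCofan.IsColimit.mk _ (fun {T} f g => desc T f g)
      (fun {T} f g => hom_ext_apply fun z : S => by
        change (desc T f g).hom.hom z.1 = f.hom.hom z
        rw [desc_applyS T f g z.1 z.2])
      (fun {T} f g => hom_ext_apply fun z : (Sᶜ : Set X.obj.V) => by
        change (desc T f g).hom.hom z.1 = g.hom.hom z
        rw [desc_applySc T f g z.1 z.2])
      (fun {T} f g m hm₁ hm₂ => by
        have h₁ : ∀ z : S, m.hom.hom (z.1 : X.obj.V) = f.hom.hom z := fun z =>
          congrArg (fun k : sub S hS ⟶ T => k.hom.hom z) hm₁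
        have h₂ : ∀ z : (Sᶜ : Set X.obj.V), m.hom.hom (z.1 : X.obj.V) = g.hom.hom z := fun z =>
          congrArg (fun k : sub Sᶜ hSc ⟶ T => k.hom.hom z) hm₂
        exact hom_ext_apply fun z : X.obj.V => by
          by_cases hz : z ∈ S
          · exact (h₁ ⟨z, hz⟩).trans (desc_applyS T f g z hz).symm
          · exact (h₂ ⟨z, hz⟩).trans (desc_applySc T f g z hz).symm)
  have hne₁ : IsNonemptyObj (sub S hS) := isNonemptyObj_of_nonempty' _ (⟨x, hxS⟩ : S)
  have hne₂ : IsNonemptyObj (sub Sᶜ hSc) := isNonemptyObj_of_nonempty' _ (⟨y, hyS⟩ : (Sᶜ : Set _))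
  exact (hX.2 (sub S hS) (sub Sᶜ hSc) (incl S hS) (incl Sᶜ hSc) hne₁ hne₂).false hcolim

/-- Connected objects of `B(G)` are exactly the nonempty single orbits — arbitrary topology on `G`.
[cite: MochizukiFrdI2008, §0 p.15] -/
theorem isConnectedObj_iff' (X : BCat G) :
    IsConnectedObj X ↔ ∃ x₀ : X.obj.V, ∀ x : X.obj.V, ∃ g : G, g • x₀ = x :=
  ⟨fun hX => (nonempty_of_isNonemptyObj X hX.1).elim fun x₀ =>
    ⟨x₀, fun x => exists_smul_eq_of_isConnectedObj' X hX x₀ x⟩,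
    fun ⟨x₀, htr⟩ => isConnectedObj_of_transitive' X x₀ htr⟩

/-- Two morphisms out of a connected object of `B(G)` that agree at one point are equal — arbitrary
topology on `G`. [cite: MochizukiFrdI2008, §0 p.15] -/
theorem hom_eq_of_apply_eq' {X Y : BCat G} (hX : IsConnectedObj X)
    {f f' : X ⟶ Y} (x₀ : X.obj.V) (h : f.hom.hom x₀ = f'.hom.hom x₀) : f = f' :=
  hom_eq_of_apply_eq_of_transitive x₀ (fun x => exists_smul_eq_of_isConnectedObj' X hX x₀ x) h

/-- A morphism from an object with a point to a connected object of `B(G)` is surjective — arbitrary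
topology on `G`. [cite: MochizukiFrdI2008, §0 p.15] -/
theorem surjective_of_isConnectedObj' {X Y : BCat G} (f : X ⟶ Y)
    (x : X.obj.V) (hY : IsConnectedObj Y) : Function.Surjective f.hom.hom :=
  surjective_of_transitive f x (f.hom.hom x)
    (fun y => exists_smul_eq_of_isConnectedObj' Y hY _ y)

/-- A morphism from a non-initial object to a connected object of `B(G)` is an epimorphism — arbitrary
topology on `G`. [cite: MochizukiFrdI2008, §0 p.15] -/
theorem epi_of_isConnectedObj' {X Y : BCat G} (f : X ⟶ Y)
    (hX : IsNonemptyObj X) (hY : IsConnectedObj Y) : Epi f := by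
  obtain ⟨x⟩ := nonempty_of_isNonemptyObj X hX
  exact epi_of_surjective f (surjective_of_isConnectedObj' f x hY)

/-! ### The test objects: the orbit of a pair `(q, q')` in `Q × Q'` -/

/-- For points `q ∈ Q`, `q' ∈ Q'` of objects of `B(G)` (ANY topology on `G`), the `G`-orbit of the pair
`(q, q')` in `Q × Q'` is an object of `B(G)` (a transporter of a pair is the intersection of two
transporters) with base point `o = (q, q')` of stabiliser `Stab(q) ∩ Stab(q')`; it is a single orbit,
and for every object `Y` and point `y` with `Stab(q) ∩ Stab(q') ⊆ Stab(y)` there is a morphism to `Y`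
sending `o ↦ y` (`g·o ↦ g·y`).  Replaces the coset object `G/(Stab(q) ∩ Stab(q'))` of
`BCatOrbits.exists_coset_obj`. [cite: MochizukiFrdI2008, §0 p.13] -/
theorem exists_pairOrbit_obj (Q Q' : BCat G) (q : Q.obj.V) (q' : Q'.obj.V) :
    ∃ (O : BCat G) (o : O.obj.V),
      MulAction.stabilizer G o = MulAction.stabilizer G q ⊓ MulAction.stabilizer G q' ∧
      (∀ z : O.obj.V, ∃ g : G, g • o = z) ∧
      ∀ (Y : BCat G) (y : Y.obj.V),
        MulAction.stabilizer G q ⊓ MulAction.stabilizer G q' ≤ MulAction.stabilizer G y →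
        ∃ b : O ⟶ Y, b.hom.hom o = y := by
  classical
  let p₀ : Q.obj.V × Q'.obj.V := (q, q')
  let T : Set (Q.obj.V × Q'.obj.V) := MulAction.orbit G p₀
  haveI : Fintype T := Fintype.ofFinite T
  have hT : ∀ (g : G) (z : Q.obj.V × Q'.obj.V), z ∈ T → g • z ∈ T := fun g z hz => by
    obtain ⟨g', rfl⟩ := MulAction.mem_orbit_iff.mp hz
    exact MulAction.mem_orbit_iff.mpr ⟨g * g', mul_smul g g' p₀⟩
  let OA : Action FintypeCat.{u} G :=
    { V := FintypeCat.of T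
      ρ :=
        { toFun := fun g => FintypeCat.homMk fun z : T => (⟨g • z.1, hT g z.1 z.2⟩ : T)
          map_one' := FintypeCat.hom_ext _ _ fun z => Subtype.ext (one_smul G z.1)
          map_mul' := fun g h => FintypeCat.hom_ext _ _ fun z => Subtype.ext (mul_smul g h z.1) } }
  have smul_def : ∀ (g : G) (z : OA.V), g • z = (⟨g • (z : T).1, hT g (z : T).1 (z : T).2⟩ : T) :=
    fun _ _ => rfl
  have hO : Action.IsContinuous OA :=
    (isContinuous_iff_isOpen_setOf_smul_eq OA).mpr fun z w => by
      convert (isOpen_setOf_smul_eq Q (z : T).1.1 (w : T).1.1).inter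
        (isOpen_setOf_smul_eq Q' (z : T).1.2 (w : T).1.2) using 1
      ext g
      simp only [Set.mem_setOf_eq, Set.mem_inter_iff]
      constructor
      · intro h
        have h' := congrArg Subtype.val h
        exact ⟨congrArg Prod.fst h', congrArg Prod.snd h'⟩
      · rintro ⟨h₁, h₂⟩
        exact Subtype.ext (Prod.ext h₁ h₂)
  -- a section of the orbit map `g ↦ g·(q, q')`
  obtain ⟨s, hs⟩ : ∃ s : T → G, ∀ z : T, s z • p₀ = z.1 :=
    ⟨fun z => Classical.choose (MulAction.mem_orbit_iff.mp z.2),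
      fun z => Classical.choose_spec (MulAction.mem_orbit_iff.mp z.2)⟩
  have stab_o : MulAction.stabilizer G ((⟨p₀, MulAction.mem_orbit_self p₀⟩ : T) : OA.V) =
      MulAction.stabilizer G q ⊓ MulAction.stabilizer G q' := by
    ext g
    simp only [Subgroup.mem_inf, MulAction.mem_stabilizer_iff, smul_def]
    constructor
    · intro h
      have h' := congrArg Subtype.val h
      exact ⟨congrArg Prod.fst h', congrArg Prod.snd h'⟩
    · rintro ⟨h₁, h₂⟩
      exact Subtype.ext (Prod.ext h₁ h₂)
  have htr : ∀ z : OA.V, ∃ g : G, g • ((⟨p₀, MulAction.mem_orbit_self p₀⟩ : T) : OA.V) = z :=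
    fun z => by
    obtain ⟨g, hg⟩ := MulAction.mem_orbit_iff.mp (z : T).2
    exact ⟨g, Subtype.ext hg⟩
  -- `g·(q,q') ↦ g·y` is well defined as soon as `Stab(q) ∩ Stab(q') ⊆ Stab(y)`
  have hwd : ∀ (Y : BCat G) (y : Y.obj.V),
      MulAction.stabilizer G q ⊓ MulAction.stabilizer G q' ≤ MulAction.stabilizer G y →
      ∀ (g g' : G), g • p₀ = g' • p₀ → g • y = g' • y := fun Y y hy g g' hgg' => by
    have h1 : g • q = g' • q := congrArg Prod.fst hgg'
    have h2 : g • q' = g' • q' := congrArg Prod.snd hgg'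
    have hmem : g⁻¹ * g' ∈ MulAction.stabilizer G q ⊓ MulAction.stabilizer G q' := by
      refine Subgroup.mem_inf.mpr ⟨?_, ?_⟩
      · rw [MulAction.mem_stabilizer_iff, mul_smul, ← h1, inv_smul_smul]
      · rw [MulAction.mem_stabilizer_iff, mul_smul, ← h2, inv_smul_smul]
    have := hy hmem
    rw [MulAction.mem_stabilizer_iff, mul_smul, inv_smul_eq_iff] at this
    exact this.symm
  refine ⟨⟨OA, hO⟩, ((⟨p₀, MulAction.mem_orbit_self p₀⟩ : T) : OA.V), stab_o, htr,
    fun Y y hy => ?_⟩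
  refine ⟨ObjectProperty.homMk
    { hom := FintypeCat.homMk fun z : T => s z • y
      comm := fun g₀ => FintypeCat.hom_ext _ _ fun z : T => by
        change s ⟨g₀ • z.1, hT g₀ z.1 z.2⟩ • y = g₀ • (s z • y)
        rw [← mul_smul]
        apply hwd Y y hy
        rw [hs ⟨g₀ • z.1, hT g₀ z.1 z.2⟩, mul_smul, hs z] }, ?_⟩
  change s ⟨p₀, MulAction.mem_orbit_self p₀⟩ • y = y
  have h1 := hwd Y y hy (s ⟨p₀, MulAction.mem_orbit_self p₀⟩) 1
    ((hs ⟨p₀, MulAction.mem_orbit_self p₀⟩).trans (one_smul G p₀).symm)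
  rwa [one_smul] at h1

/-- A monomorphism of `B(G)` is injective on points (test against the orbit of `(x, x')` in `X × X`) —
arbitrary topology on `G`. [cite: MochizukiFrdI2008, §0 p.13] -/
theorem injective_of_mono' {X Y : BCat G} (f : X ⟶ Y) [Mono f] :
    Function.Injective f.hom.hom := by
  intro x x' e
  obtain ⟨Q, q₀, -, htr, hmap⟩ := exists_pairOrbit_obj X X x x'
  obtain ⟨b, hb⟩ := hmap X x inf_le_left
  obtain ⟨b', hb'⟩ := hmap X x' inf_le_right
  have hbb' : b ≫ f = b' ≫ f :=
    hom_eq_of_apply_eq_of_transitive q₀ htr (by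
      change f.hom.hom (b.hom.hom q₀) = f.hom.hom (b'.hom.hom q₀)
      rw [hb, hb', e])
  have := congrArg (fun k : Q ⟶ X => k.hom.hom q₀) (cancel_mono f |>.mp hbb')
  simpa [hb, hb'] using this

end BCat

end Literature.AlgebraicGeometry.Frobenioids
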